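import Summits.AtomisticToContinuum.FouriersLaw.Theses.PhononMeanFreePath
import Summits.AtomisticToContinuum.FouriersLaw.Theorems.PhononMeanFreePathDefs
import Summits.AtomisticToContinuum.FouriersLaw.Theorems.PhononMeanFreePathCoherentDephasingWeakCouplingIntegrability
import Summits.AtomisticToContinuum.FouriersLaw.Theorems.PhononMeanFreePathCoherentDephasingKickDuhamel
import Summits.AtomisticToContinuum.FouriersLaw.Theorems.PhononMeanFreePathIncoherentBoundedCoherentLandauer
import Summits.AtomisticToContinuum.FouriersLaw.Theorems.PhononMeanFreePathCoherentDephasingHeadBound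

/-!
# Strict absorption (skeleton) — line `Sketch`, crux `PhononMeanFreePath.CoherentDephasing` (stmt-AtomisticToContinuum-11810), lead c2

`N`-uniform STRICT ABSORPTION of the coherent kick: `∃ c > 0, ∀ N ≥ N₀, γ(∫₀^∞ m_0² + ∫₀^∞ m_N²) ≤ T²/2 - c`,
i.e. the total anharmonic work `W_N = T²/2 - γ∫(m_0²+m_N²)` (landed total balance) is bounded BELOW uniformly in the
length. Sub-goals `sa_*` (registered stubs of the crux item, `--supports`); assembly `strictAbsorption`.
-/

noncomputable section

open MeasureTheory ProbabilityTheory Filter Topology Set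
open scoped NNReal ENNReal

namespace Summit.AtomisticToContinuum.FouriersLaw.Theorems.CoherentDephasing.StrictAbsorption

open Literature.MathematicalPhysics.KineticTheory.HeatConduction
open Literature.MathematicalPhysics.KineticTheory Literature.Probability.Process OscillatorChain
open Summit.AtomisticToContinuum.FouriersLaw.Theorems.PhononMeanFreePath

/-- SUB-GOAL K1 (reflection symmetry of the equilibrium kernels): `⟨p_0, K_t p_N⟩_μ = ⟨p_N, K_t p_0⟩_μ` for the `(N+1)`-site chain with both baths at `T` (site reflection `x ↦ N - x` conjugates the constructed kernels and preserves the Gibbs measure). [folklore] -/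
theorem sa_reflect :
    ∀ ω₂ lam β γ : ℝ, 0 < ω₂ → 0 < lam → 0 < β → 0 < γ → ∀ T : ℝ, 0 < T → ∀ (N : ℕ) (t : ℝ), ∫ z, z.2 0 * (∫ y, y.2 (Fin.last N) ∂((pinnedChain ω₂ lam β γ).transitionKernel (N + 1) T T t.toNNReal z)) ∂((pinnedChain ω₂ lam β γ).gibbsMeasure (N + 1) T) = ∫ z, z.2 (Fin.last N) * (∫ y, y.2 0 ∂((pinnedChain ω₂ lam β γ).transitionKernel (N + 1) T T t.toNNReal z)) ∂((pinnedChain ω₂ lam β γ).gibbsMeasure (N + 1) T) := by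
  sorry

/-- SUB-GOAL K2 (Dynkin's identity for the polynomial class): `C²` observables `e` with `|e|, |∂_{p_0}e|, |∂_{p_{n-1}}e|, |Le| ≤ C(1+H)^k` satisfy `K_r e(z) - e(z) = ∫₀ʳ K_s(Le)(z) ds` pointwise (generalises `pinnedChain_dynkin_of_linearGrowth`). [cite: CuneoEckmannHairerReyBellet2018, §3 eq. (3.2)–(3.4)] -/
theorem sa_polyDynkin :
    ∀ ω₂ lam β γ : ℝ, 0 < ω₂ → 0 < lam → 0 < β → 0 < γ → ∀ T : ℝ, 0 < T → ∀ (n k : ℕ) (hn : 0 < n) (e ℓ : PhaseSpace n → ℝ) (Ce D B : ℝ), ContDiff ℝ 2 e → (∀ x, (pinnedChain ω₂ lam β γ).generator n T T e x = ℓ x) → 0 ≤ Ce → 0 ≤ D → 0 ≤ B → (∀ y, |e y| ≤ Ce * (1 + (pinnedChain ω₂ lam β γ).hamiltonian n y) ^ k) → (∀ y, |partialP ⟨0, hn⟩ e y| ≤ D * (1 + (pinnedChain ω₂ lam β γ).hamiltonian n y) ^ k) → (∀ y, |partialP ⟨n - 1, Nat.sub_lt hn one_pos⟩ e y| ≤ D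 * (1 + (pinnedChain ω₂ lam β γ).hamiltonian n y) ^ k) → (∀ y, |ℓ y| ≤ B * (1 + (pinnedChain ω₂ lam β γ).hamiltonian n y) ^ k) → ∀ (r : NNReal) (z : PhaseSpace n), ∫ y, e y ∂((pinnedChain ω₂ lam β γ).transitionKernel n T T r z) - e z = ∫ s in (0 : ℝ)..(r : ℝ), ∫ y, ℓ y ∂((pinnedChain ω₂ lam β γ).transitionKernel n T T s.toNNReal z) := by
  sorry

/-- SUB-GOAL K4a (generator algebra at the kicked site): `L p_0 = G₁`, `L G₁ = G₂` explicitly, and `G₁, G₂ ∈ C²`. [folklore] -/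
theorem sa_generatorAlgebra :
    ∀ ω₂ lam β γ : ℝ, 0 < ω₂ → 0 < lam → 0 < β → 0 < γ → ∀ T : ℝ, 0 < T → ∀ (N : ℕ) (hN : 2 ≤ N), (∀ z : PhaseSpace (N + 1), (pinnedChain ω₂ lam β γ).generator (N + 1) T T (fun y => y.2 0) z = (-(ω₂ * z.1 0 + lam * z.1 0 ^ 3) + ((z.1 ⟨1, by omega⟩ - z.1 0) + β * (z.1 ⟨1, by omega⟩ - z.1 0) ^ 3) - γ * z.2 0)) ∧ (∀ z : PhaseSpace (N + 1), (pinnedChain ω₂ lam β γ).generator (N + 1) T T (fun y : PhaseSpace (N + 1) => (-(ω₂ * y.1 0 + lam * y.1 0 ^ 3) + ((y.1 ⟨1, by omega⟩ - y.1 0) + β * (y.1 ⟨1, by omega⟩ - y.1 0) ^ 3) - γ * y.2 0)) z = (-(z.2 0 * (ω₂ + 3 * lam * z.1 0 ^ 2 + 1 + 3 * β * (z.1 ⟨1, by omega⟩ - z.1 0) ^ 2)) + z.2 ⟨1, by omega⟩ * (1 + 3 * β * (z.1 ⟨1, by omega⟩ - z.1 0) ^ 2) + γ * (ω₂ * z.1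 0 + lam * z.1 0 ^ 3 - ((z.1 ⟨1, by omega⟩ - z.1 0) + β * (z.1 ⟨1, by omega⟩ - z.1 0) ^ 3)) + γ ^ 2 * z.2 0)) ∧ ContDiff ℝ 2 (fun y : PhaseSpace (N + 1) => (-(ω₂ * y.1 0 + lam * y.1 0 ^ 3) + ((y.1 ⟨1, by omega⟩ - y.1 0) + β * (y.1 ⟨1, by omega⟩ - y.1 0) ^ 3) - γ * y.2 0)) ∧ ContDiff ℝ 2 (fun y : PhaseSpace (N + 1) => (-(y.2 0 * (ω₂ + 3 * lam * y.1 0 ^ 2 + 1 + 3 * β * (y.1 ⟨1, by omega⟩ - y.1 0) ^ 2)) + y.2 ⟨1, by omega⟩ * (1 + 3 * β * (y.1 ⟨1, by omega⟩ - y.1 0) ^ 2) + γ * (ω₂ * y.1 0 + lam * y.1 0 ^ 3 - ((y.1 ⟨1, by omega⟩ - y.1 0) + β * (y.1 ⟨1, by omega⟩ - y.1 0) ^ 3)) + γ ^ 2 * y.2 0)) := by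
  sorry

/-- SUB-GOAL K4a' (third generator power): `L G₂ = G₃` for some continuous `G₃` with `|G₃| ≤ B(1+H)³` and an `N`-UNIFORM local polynomial bound `|G₃| ≤ C₃(1 + Σ_{i≤2}(q_i⁶ + p_i⁶))`. [folklore] -/
theorem sa_generatorCube :
    ∀ ω₂ lam β γ : ℝ, 0 < ω₂ → 0 < lam → 0 < β → 0 < γ → ∀ T : ℝ, 0 < T → ∃ C₃ : ℝ, ∀ (N : ℕ) (hN : 2 ≤ N), ∃ G₃ : PhaseSpace (N + 1) → ℝ, Continuous G₃ ∧ (∀ z : PhaseSpace (N + 1), (pinnedChain ω₂ lam β γ).generator (N + 1) T T (fun y : PhaseSpace (N + 1) => (-(y.2 0 * (ω₂ + 3 * lam * y.1 0 ^ 2 + 1 + 3 * β * (y.1 ⟨1, by omega⟩ - y.1 0) ^ 2)) + y.2 ⟨1, by omega⟩ * (1 + 3 * β * (y.1 ⟨1, by omega⟩ - y.1 0) ^ 2) + γ * (ω₂ * y.1 0 + lam * y.1 0 ^ 3 - ((y.1 ⟨1, by omega⟩ - y.1 0) + β * (y.1 ⟨1, by omega⟩ - y.1 0) ^ 3)) +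 γ ^ 2 * y.2 0)) z = G₃ z) ∧ (∃ B : ℝ, ∀ z, |G₃ z| ≤ B * (1 + (pinnedChain ω₂ lam β γ).hamiltonian (N + 1) z) ^ 3) ∧ (∀ z, |G₃ z| ≤ C₃ * (1 + ∑ i : Fin (N + 1), if (i : ℕ) ≤ 2 then z.1 i ^ 6 + z.2 i ^ 6 else 0)) := by
  sorry

/-- SUB-GOAL K4c (growth and bath-derivative bounds): `G₁, G₂` and their `∂_{p_0}`, `∂_{p_N}` derivatives are `O((1+H)²)`, `Φ = U''(q_0)+V''(q_1-q_0) = O(1+H)`. [folklore] -/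
theorem sa_classBounds :
    ∀ ω₂ lam β γ : ℝ, 0 < ω₂ → 0 < lam → 0 < β → 0 < γ → ∀ T : ℝ, 0 < T → ∀ (N : ℕ) (hN : 2 ≤ N), ∃ Cb : ℝ, 0 ≤ Cb ∧ ∀ z : PhaseSpace (N + 1), |(-(ω₂ * z.1 0 + lam * z.1 0 ^ 3) + ((z.1 ⟨1, by omega⟩ - z.1 0) + β * (z.1 ⟨1, by omega⟩ - z.1 0) ^ 3) - γ * z.2 0)| ≤ Cb * (1 + (pinnedChain ω₂ lam β γ).hamiltonian (N + 1) z) ^ 2 ∧ |(-(z.2 0 * (ω₂ + 3 * lam * z.1 0 ^ 2 + 1 + 3 * β * (z.1 ⟨1, by omega⟩ - z.1 0) ^ 2)) + z.2 ⟨1, by omega⟩ * (1 + 3 * β * (z.1 ⟨1, by omega⟩ - z.1 0) ^ 2) + γ * (ω₂ * z.1 0 + lam * z.1 0 ^ 3 - ((z.1 ⟨1, by omega⟩ - z.1 0) + β * (z.1 ⟨1, by omega⟩ - z.1 0) ^ 3)) + γ ^ 2 * z.2 0)| ≤ Cb * (1 + (pinnedChain ω₂ lam β γ).hamiltonian (N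 + 1) z) ^ 2 ∧ |partialP 0 (fun y : PhaseSpace (N + 1) => (-(ω₂ * y.1 0 + lam * y.1 0 ^ 3) + ((y.1 ⟨1, by omega⟩ - y.1 0) + β * (y.1 ⟨1, by omega⟩ - y.1 0) ^ 3) - γ * y.2 0)) z| ≤ Cb * (1 + (pinnedChain ω₂ lam β γ).hamiltonian (N + 1) z) ^ 2 ∧ |partialP (Fin.last N) (fun y : PhaseSpace (N + 1) => (-(ω₂ * y.1 0 + lam * y.1 0 ^ 3) + ((y.1 ⟨1, by omega⟩ - y.1 0) + β * (y.1 ⟨1, by omega⟩ - y.1 0) ^ 3) - γ * y.2 0)) z| ≤ Cb * (1 + (pinnedChain ω₂ lam β γ).hamiltonian (N + 1) z) ^ 2 ∧ |partialP 0 (fun y : PhaseSpace (N + 1) => (-(y.2 0 * (ω₂ + 3 * lam * y.1 0 ^ 2 + 1 + 3 * β * (y.1 ⟨1, by omega⟩ - y.1 0) ^ 2)) + y.2 ⟨1, by omega⟩ * (1 + 3 * β * (y.1 ⟨1, by omega⟩ - y.1 0) ^ 2) + γ * (ω₂ * y.1 0 + lam * y.1 0 ^ 3 - ((y.1 ⟨1,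 by omega⟩ - y.1 0) + β * (y.1 ⟨1, by omega⟩ - y.1 0) ^ 3)) + γ ^ 2 * y.2 0)) z| ≤ Cb * (1 + (pinnedChain ω₂ lam β γ).hamiltonian (N + 1) z) ^ 2 ∧ |partialP (Fin.last N) (fun y : PhaseSpace (N + 1) => (-(y.2 0 * (ω₂ + 3 * lam * y.1 0 ^ 2 + 1 + 3 * β * (y.1 ⟨1, by omega⟩ - y.1 0) ^ 2)) + y.2 ⟨1, by omega⟩ * (1 + 3 * β * (y.1 ⟨1, by omega⟩ - y.1 0) ^ 2) + γ * (ω₂ * y.1 0 + lam * y.1 0 ^ 3 - ((y.1 ⟨1, by omega⟩ - y.1 0) + β * (y.1 ⟨1, by omega⟩ - y.1 0) ^ 3)) + γ ^ 2 * y.2 0)) z| ≤ Cb * (1 + (pinnedChain ω₂ lam β γ).hamiltonian (N + 1) z) ^ 2 ∧ |(ω₂ + 3 * lam * z.1 0 ^ 2 + 1 + 3 * β * (z.1 ⟨1, by omega⟩ - z.1 0) ^ 2)| ≤ Cb * (1 + (pinnedChain ω₂ lam β γ).hamiltonian (N + 1) z) := by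
  sorry

/-- SUB-GOAL K4b (Gaussian-momentum statics of the Gibbs measure): with `Φ̃ = Φ - ⟨Φ⟩`, `a = p_0 Φ̃`: `⟨a, p_0⟩ = 0`, `⟨a, G₁⟩ = 0`, `⟨a, G₂⟩ = -T Var(Φ)`, `‖a‖² = T Var(Φ)`. [folklore] -/
theorem sa_statics :
    ∀ ω₂ lam β γ : ℝ, 0 < ω₂ → 0 < lam → 0 < β → 0 < γ → ∀ T : ℝ, 0 < T → ∀ (N : ℕ) (hN : 2 ≤ N), (∫ z, (z.2 0 * ((ω₂ + 3 * lam * z.1 0 ^ 2 + 1 + 3 * β * (z.1 ⟨1, by omega⟩ - z.1 0) ^ 2) - ∫ x, (ω₂ + 3 * lam * x.1 0 ^ 2 + 1 + 3 * β * (x.1 ⟨1, by omega⟩ - x.1 0) ^ 2) ∂((pinnedChain ω₂ lam β γ).gibbsMeasure (N + 1) T))) * z.2 0 ∂((pinnedChain ω₂ lam β γ).gibbsMeasure (N + 1) T) = 0) ∧ (∫ z, (z.2 0 * ((ω₂ + 3 * lam * z.1 0 ^ 2 + 1 + 3 * β * (z.1 ⟨1, by omega⟩ - z.1 0) ^ 2)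 - ∫ x, (ω₂ + 3 * lam * x.1 0 ^ 2 + 1 + 3 * β * (x.1 ⟨1, by omega⟩ - x.1 0) ^ 2) ∂((pinnedChain ω₂ lam β γ).gibbsMeasure (N + 1) T))) * (-(ω₂ * z.1 0 + lam * z.1 0 ^ 3) + ((z.1 ⟨1, by omega⟩ - z.1 0) + β * (z.1 ⟨1, by omega⟩ - z.1 0) ^ 3) - γ * z.2 0) ∂((pinnedChain ω₂ lam β γ).gibbsMeasure (N + 1) T) = 0) ∧ (∫ z, (z.2 0 * ((ω₂ + 3 * lam * z.1 0 ^ 2 + 1 + 3 * β * (z.1 ⟨1, by omega⟩ - z.1 0) ^ 2) - ∫ x, (ω₂ + 3 * lam * x.1 0 ^ 2 + 1 + 3 * β * (x.1 ⟨1, by omega⟩ - x.1 0) ^ 2) ∂((pinnedChain ω₂ lam β γ).gibbsMeasure (N + 1) T))) * (-(z.2 0 * (ω₂ + 3 * lam * z.1 0 ^ 2 + 1 + 3 * β * (z.1 ⟨1, by omega⟩ - z.1 0) ^ 2)) + z.2 ⟨1, by omega⟩ * (1 + 3 * β * (z.1 ⟨1, by omega⟩ - z.1 0) ^ 2) + γ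 * (ω₂ * z.1 0 + lam * z.1 0 ^ 3 - ((z.1 ⟨1, by omega⟩ - z.1 0) + β * (z.1 ⟨1, by omega⟩ - z.1 0) ^ 3)) + γ ^ 2 * z.2 0) ∂((pinnedChain ω₂ lam β γ).gibbsMeasure (N + 1) T) = -(T * ∫ z, ((ω₂ + 3 * lam * z.1 0 ^ 2 + 1 + 3 * β * (z.1 ⟨1, by omega⟩ - z.1 0) ^ 2) - ∫ x, (ω₂ + 3 * lam * x.1 0 ^ 2 + 1 + 3 * β * (x.1 ⟨1, by omega⟩ - x.1 0) ^ 2) ∂((pinnedChain ω₂ lam β γ).gibbsMeasure (N + 1) T)) ^ 2 ∂((pinnedChain ω₂ lam β γ).gibbsMeasure (N + 1) T))) ∧ (∫ z, (z.2 0 * ((ω₂ + 3 * lam * z.1 0 ^ 2 + 1 + 3 * β * (z.1 ⟨1, by omega⟩ - z.1 0) ^ 2) - ∫ x, (ω₂ + 3 * lam * x.1 0 ^ 2 + 1 + 3 * β * (x.1 ⟨1, by omega⟩ - x.1 0) ^ 2) ∂((pinnedChain ω₂ lam β γ).gibbsMeasure (N + 1) T))) ^ 2 ∂((pinnedChain ω₂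 lam β γ).gibbsMeasure (N + 1) T) = T * ∫ z, ((ω₂ + 3 * lam * z.1 0 ^ 2 + 1 + 3 * β * (z.1 ⟨1, by omega⟩ - z.1 0) ^ 2) - ∫ x, (ω₂ + 3 * lam * x.1 0 ^ 2 + 1 + 3 * β * (x.1 ⟨1, by omega⟩ - x.1 0) ^ 2) ∂((pinnedChain ω₂ lam β γ).gibbsMeasure (N + 1) T)) ^ 2 ∂((pinnedChain ω₂ lam β γ).gibbsMeasure (N + 1) T)) := by
  sorry

/-- SUB-GOAL K5 (`N`-uniform non-degeneracy of the local curvature): `Var_{μ_N}(Φ) ≥ v₀ > 0` for all `N ≥ 2` (Cramér–Rao via Gibbs integration by parts in `q_0`, twice; `N`-uniform moments). [folklore] -/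
theorem sa_varianceFloor :
    ∀ ω₂ lam β γ : ℝ, 0 < ω₂ → 0 < lam → 0 < β → 0 < γ → ∀ T : ℝ, 0 < T → ∃ v₀ : ℝ, 0 < v₀ ∧ ∀ (N : ℕ) (hN : 2 ≤ N), v₀ ≤ ∫ z, ((ω₂ + 3 * lam * z.1 0 ^ 2 + 1 + 3 * β * (z.1 ⟨1, by omega⟩ - z.1 0) ^ 2) - ∫ x, (ω₂ + 3 * lam * x.1 0 ^ 2 + 1 + 3 * β * (x.1 ⟨1, by omega⟩ - x.1 0) ^ 2) ∂((pinnedChain ω₂ lam β γ).gibbsMeasure (N + 1) T)) ^ 2 ∂((pinnedChain ω₂ lam β γ).gibbsMeasure (N + 1) T) := by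
  sorry

/-- SUB-GOAL K3 (joint Landauer bound with a which-path witness; held by the lead): `Var(Φ)·[(∫p_0 K_s p_0)² + (∫p_N K_s p_0)²] + (∫ p_0Φ̃ K_s p_0)² ≤ Var(Φ)·T² ∫ (∂_{p_0}K_s p_0)² + Var(Φ) T²∫(∂_{p_N}K_s p_0)²` integrated in `s` with the Bakry–Émery dissipation inequality: `≤ Var(Φ)·T²/(2γ)`. [folklore] -/
theorem sa_landauerWitness :
    ∀ ω₂ lam β γ : ℝ, 0 < ω₂ → 0 < lam → 0 < β → 0 < γ → ∀ T : ℝ, 0 < T → ∀ (N : ℕ) (hN : 2 ≤ N), ∫⁻ s in Set.Ioi (0 : ℝ), ENNReal.ofReal ((∫ z, ((ω₂ + 3 * lam * z.1 0 ^ 2 + 1 + 3 * β * (z.1 ⟨1, by omega⟩ - z.1 0) ^ 2) - ∫ x, (ω₂ + 3 * lam * x.1 0 ^ 2 + 1 + 3 * β * (x.1 ⟨1, by omega⟩ - x.1 0) ^ 2) ∂((pinnedChain ω₂ lam β γ).gibbsMeasure (N + 1) T)) ^ 2 ∂((pinnedChain ω₂ lam β γ).gibbsMeasure (N + 1) T))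 * ((∫ z, z.2 0 * (∫ y, y.2 0 ∂((pinnedChain ω₂ lam β γ).transitionKernel (N + 1) T T s.toNNReal z)) ∂((pinnedChain ω₂ lam β γ).gibbsMeasure (N + 1) T)) ^ 2 + (∫ z, z.2 (Fin.last N) * (∫ y, y.2 0 ∂((pinnedChain ω₂ lam β γ).transitionKernel (N + 1) T T s.toNNReal z)) ∂((pinnedChain ω₂ lam β γ).gibbsMeasure (N + 1) T)) ^ 2) + (∫ z, (z.2 0 * ((ω₂ + 3 * lam * z.1 0 ^ 2 + 1 + 3 * β * (z.1 ⟨1, by omega⟩ - z.1 0) ^ 2) - ∫ x, (ω₂ + 3 * lam * x.1 0 ^ 2 + 1 + 3 * β * (x.1 ⟨1, by omega⟩ - x.1 0) ^ 2) ∂((pinnedChain ω₂ lam β γ).gibbsMeasure (N + 1) T))) * (∫ y, y.2 0 ∂((pinnedChain ω₂ lam β γ).transitionKernel (N + 1) T T s.toNNReal z)) ∂((pinnedChain ω₂ lam β γ).gibbsMeasure (N + 1) T)) ^ 2) ≤ ENNReal.ofReal ((∫ z, ((ω₂ + 3 * lam * z.1 0 ^ 2 + 1 + 3 * β * (z.1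 ⟨1, by omega⟩ - z.1 0) ^ 2) - ∫ x, (ω₂ + 3 * lam * x.1 0 ^ 2 + 1 + 3 * β * (x.1 ⟨1, by omega⟩ - x.1 0) ^ 2) ∂((pinnedChain ω₂ lam β γ).gibbsMeasure (N + 1) T)) ^ 2 ∂((pinnedChain ω₂ lam β γ).gibbsMeasure (N + 1) T)) * (T ^ 2 / (2 * γ))) := by
  sorry

end Summit.AtomisticToContinuum.FouriersLaw.Theorems.CoherentDephasing.StrictAbsorption

end
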